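import Summits.ResolutionOfSingularities.ResolutionOfSingularities.Theorems.EquisingularLiftEquisingularLiftNatLinearCentreKill
import Summits.ResolutionOfSingularities.ResolutionOfSingularities.Theorems.EquisingularLiftEquisingularLiftLinearCentreComap
import HarnessLib

/-!
# [OURS · L1 W4.5(b)] EL♮ helper (R1, part 4) — LINEAR CENTRES OVER `O`: chart ideals of the `k`-linear subspace and of its
# inverse image along any `j : H → ℙ^N_k` (general set of killed variables)

Cell res-hironaka, LADDER-RESOLUTION rung L (D-0089), slot W4.5(b), crux `Theses.EquisingularLift.EquisingularLiftNat`
(stmt-ResolutionOfSingularities-20038), object **(R1)** of res-L1-w45b-plan-1's ORDERS 2026-08-27T05:49:16Z, optional item (P8)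
of the SIGNATURE 06:02:48Z, `--supports stmt-ResolutionOfSingularities-20038 --as helper`. NOT a statement of any manuscript;
OURS. AI-written; AI review is weaker than expert review.

Setting: parts 1–3 (`…NatLinearCentreKill/…NatLinearCentre/…NatLinearCentrePoints.lean`): the kill map `f` of the variables
outside `range e` (`e : Fin (r+1) → Fin (N+1)` injective), carried def-free, and `Λ_k := (Proj.map f _).ker` on `ℙ^N_k`. This
file is the general-`e` transcription of the p-tree `StrataSplit.LinearCentre.ker_projMap_kill_ideal_basicOpen`
(`…LinearCentreCharts.lean`) and `comap_ker_kill_ideal_preimage` / `comap_ker_kill_eq_of_charts` (`…LinearCentreComap.lean`),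
i.e. the currency in which a specimen checks its DOWNSTAIRS blow-up chart by chart:

* `ker_projMap_kill_ideal_basicOpen` — over `D₊(x_c)` the ideal of `Λ_k` is spanned by the sections `x_a / x_c`, `a ∉ range e`;
* `comap_ker_kill_ideal_preimage` — for ANY `j : H → ℙ^N_k` with `j⁻¹ D₊(x_c)` affine, `(Λ_k · 𝒪_H)(j⁻¹ D₊(x_c))` is spanned by
  the pulled-back coordinates `j^*(x_a/x_c) = GeneratingSections.homRatio j c a`, `a ∉ range e`;
* `comap_ker_kill_eq_of_charts` — hence `Λ_k · 𝒪_H = 𝔞` when the chart ideals of `𝔞` on a covering family of such charts are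
  these spans.

References: [Hartshorne1977, II Prop. 5.9, Thm. 7.1 (a)]; [GortzWedhorn2020, Example 4.36].
-/

set_option linter.dupNamespace false -- mandated namespace `Summit.<Summit>.<Problem>` of this single-conjunct summit

noncomputable section

open CategoryTheory CategoryTheory.Limits AlgebraicGeometry TopologicalSpace
open MvPolynomial HomogeneousLocalization
open Literature.AlgebraicGeometry.Resolution
open Literature.AlgebraicGeometry.Motives Literature.AlgebraicGeometry.Motives.Segre
open AlgebraicGeometry.Scheme.IdealSheafData
open Summit.ResolutionOfSingularities.ResolutionOfSingularities.Cruxes.EquisingularLift.StrataSplit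

attribute [local instance] MvPolynomial.gradedAlgebra

namespace Summit.ResolutionOfSingularities.ResolutionOfSingularities.Cruxes.EquisingularLiftNat

namespace LinearCentre

universe u

section Charts

variable {k : Type u} [CommRing k] {N r : ℕ} (e : Fin (r + 1) → Fin (N + 1)) (he : Function.Injective e)
  (fk : homogeneousSubmodule (Fin (N + 1)) k →+*ᵍ homogeneousSubmodule (Fin (r + 1)) k)
  (hfk' : HomogeneousIdeal.irrelevant (homogeneousSubmodule (Fin (r + 1)) k) ≤
    (HomogeneousIdeal.irrelevant (homogeneousSubmodule (Fin (N + 1)) k)).map fk)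
  (hfkC : ∀ a : k, fk (C a) = C a) (hfke : ∀ j : Fin (r + 1), fk (X (e j)) = X j)
  (hfk0 : ∀ i : Fin (N + 1), i ∉ Set.range e → fk (X i) = 0)

include he hfkC hfke hfk0 in
/-- **Chart ideals of the coordinate linear subspace.** Over `D₊(x_c)`, the kernel ideal sheaf of `Proj f` (the coordinate
linear subspace `V(x_a : a ∉ range e)`) is spanned by the sections `x_a / x_c`, `a ∉ range e`. Transcribed from
`StrataSplit.LinearCentre.ker_projMap_kill_ideal_basicOpen`. [cite: Hartshorne1977, II Prop. 5.9 and Ex. 3.12] -/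
theorem ker_projMap_kill_ideal_basicOpen (c : Fin (N + 1)) :
    (Proj.map fk hfk').ker.ideal ⟨Proj.basicOpen (homogeneousSubmodule (Fin (N + 1)) k) (X c),
        Proj.isAffineOpen_basicOpen _ (X c) (X_mem k c) one_pos⟩ =
      Ideal.span (Set.range fun a : {a : Fin (N + 1) // a ∉ Set.range e} =>
        (Proj.awayToSection (homogeneousSubmodule (Fin (N + 1)) k) (X c)).hom
          (mk₁ (homogeneousSubmodule (Fin (N + 1)) k) (X_mem k c) 1 (X a.1) (X_mem k a.1))) := by
  have hsurj : Function.Surjective fk := fun q => ⟨_, kill_rename e fk.toRingHom (fun a => hfkC a) (fun j => hfke j) q⟩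
  rw [ker_projMap_ideal_basicOpen fk hfk' hsurj one_pos (X_mem k c)]
  have hker : RingHom.ker fk = Ideal.span (Set.range fun a : {a : Fin (N + 1) // a ∉ Set.range e} =>
      (X a.1 : MvPolynomial (Fin (N + 1)) k)) := by
    have h := ker_kill e he fk.toRingHom (fun a => hfkC a) (fun j => hfke j) (fun i hi => hfk0 i hi)
    rw [Set.image_eq_range] at h
    exact h
  rw [hker, awayIdeal_span_eq _ (X_mem k c) (fun a : {a : Fin (N + 1) // a ∉ Set.range e} =>
      (X a.1 : MvPolynomial (Fin (N + 1)) k)) (fun _ => 1) (fun a => X_mem k a.1),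
    Ideal.map_span, ← Set.range_comp]
  rfl

include he hfkC hfke hfk0 in
/-- **The inverse image of the linear centre on an affine chart `H_c = j⁻¹ D₊(x_c)`** of ANY morphism `j : H → ℙ^N_k`: the
ideal `(Λ_k · 𝒪_H)(H_c)` is spanned by the pulled-back coordinate functions `j^*(x_a/x_c) = homRatio j c a`, `a ∉ range e`.
Transcribed from `StrataSplit.LinearCentre.comap_ker_kill_ideal_preimage`.
[cite: GortzWedhorn2020, Example 4.36] [cite: Hartshorne1977, II Prop. 5.9 and Thm. 7.1 (a)] -/
theorem comap_ker_kill_ideal_preimage {H : Scheme.{u}} (j : H ⟶ Proj (grading (Fin (N + 1)) k))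
    (c : Fin (N + 1)) (hV : IsAffineOpen (j ⁻¹ᵁ Proj.basicOpen (grading (Fin (N + 1)) k) (X c))) :
    ((Proj.map fk hfk').ker.comap j).ideal ⟨j ⁻¹ᵁ Proj.basicOpen (grading (Fin (N + 1)) k) (X c), hV⟩ =
      Ideal.span (Set.range fun a : {a : Fin (N + 1) // a ∉ Set.range e} =>
        GeneratingSections.homRatio j c a.1) := by
  rw [Literature.AlgebraicGeometry.Limits.ideal_comap_preimage j (Proj.map fk hfk').ker
      ⟨Proj.basicOpen (grading (Fin (N + 1)) k) (X c), Proj.isAffineOpen_basicOpen _ (X c) (X_mem k c) one_pos⟩ hV,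
    ker_projMap_kill_ideal_basicOpen e he fk hfk' hfkC hfke hfk0 c, Ideal.map_span, ← Set.range_comp]
  refine congrArg (fun g : {a : Fin (N + 1) // a ∉ Set.range e} →
      Γ(H, j ⁻¹ᵁ Proj.basicOpen (grading (Fin (N + 1)) k) (X c)) => Ideal.span (Set.range g))
    (funext fun a => ?_)
  rw [Function.comp_apply, GeneratingSections.homRatio_eq_appLE, Scheme.Hom.appLE_eq_app,
    Summit.ResolutionOfSingularities.ResolutionOfSingularities.Cruxes.EquisingularLift.StrataSplit.LinearCentre.mk₁_X_eq_frac]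

include he hfkC hfke hfk0 in
/-- **`Λ_k · 𝒪_H = 𝔞` from the charts.** If the charts `H_c = j⁻¹ D₊(x_c)`, `c ∈ S`, are affine and cover `H`, and on each of
them the ideal of `𝔞` is spanned by the `j^*(x_a/x_c)`, `a ∉ range e`, then the inverse image of the linear centre along `j`
is `𝔞`. Transcribed from `StrataSplit.LinearCentre.comap_ker_kill_eq_of_charts`. [cite: Hartshorne1977, II Prop. 5.9] -/
theorem comap_ker_kill_eq_of_charts {H : Scheme.{u}} (j : H ⟶ Proj (grading (Fin (N + 1)) k))
    (𝔞 : H.IdealSheafData) (S : Set (Fin (N + 1)))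
    (hV : ∀ c ∈ S, IsAffineOpen (j ⁻¹ᵁ Proj.basicOpen (grading (Fin (N + 1)) k) (X c)))
    (hcov : ⨆ c : S, j ⁻¹ᵁ Proj.basicOpen (grading (Fin (N + 1)) k) (X (c : Fin (N + 1))) = ⊤)
    (h𝔞 : ∀ (c : Fin (N + 1)) (hc : c ∈ S),
      𝔞.ideal ⟨j ⁻¹ᵁ Proj.basicOpen (grading (Fin (N + 1)) k) (X c), hV c hc⟩ =
        Ideal.span (Set.range fun a : {a : Fin (N + 1) // a ∉ Set.range e} =>
          GeneratingSections.homRatio j c a.1)) :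
    (Proj.map fk hfk').ker.comap j = 𝔞 := by
  refine Scheme.IdealSheafData.ext_of_iSup_eq_top
    (fun c : S => ⟨j ⁻¹ᵁ Proj.basicOpen (grading (Fin (N + 1)) k) (X (c : Fin (N + 1))), hV c c.2⟩) hcov
    fun c => ?_
  rw [comap_ker_kill_ideal_preimage e he fk hfk' hfkC hfke hfk0 j c (hV c c.2), h𝔞 c c.2]

end Charts

end LinearCentre

end Summit.ResolutionOfSingularities.ResolutionOfSingularities.Cruxes.EquisingularLiftNat

end
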